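import Summits.RiemannHypothesis.RiemannHypothesis.Theorems.TiltedLandingLaw421R3MenuThin

noncomputable section

/-! # «MenuThinNF» — the `R = 2` SCALING NORMAL FORM of the thin menu law, in the REAL language (C4 kernel desk rh-idea-6 g45; FILE 2)

The closed forms of #1261 (`pairReForm`, `pairCForm`) are homogeneous of degree `−1` under the dilation
`(x, t, ξ, b) ↦ (r·x, r·t, r·ξ, r·b)`, `r > 0`; hence so are the «MenuThin» numerators `footANumForm`, `topINumForm` and the datum kernel forms
`kerRe`, `kerIm`, `kerNorm`, and the two boundary forms `ThinBdryDomFormA/Ti` and the two alternatives `AltFormA/Ti` are INVARIANT under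
`(R, Hs, h, δ, t, Y, s) ↦ r·(R, Hs, h, δ, t, Y, s)` with the SAME multiplier `σ`.  Consequently the right menu law in real closed form
`RhW08.MenuThin.MenuThinRightRealSig lam` is equivalent to its `R = 2` instance `MenuThinNFRealSig lam` (window `2`, lid `1 − h`), which is the text the
kit certificate «rh33346-thincert» (C3) addresses.  (The complex-side normal form `scaleMap`/`MenuThinNFSig` of C1 rh-idea-5 g41 sketch v10 §12b/c is the
same statement up to `menuThinRightSig_iff`; this file is its real-variable twin, credited.)  Nothing here asserts the law; RH is not touched. -/

namespace RhW08.MenuThinNF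

open RhW08.SinkBdry RhW08.SinkConePos RhW08.SinkThin RhW08.MenuThin

/-! ## §1 degree `−1` homogeneity of the closed forms -/

/-- degree `−1` homogeneity of `p/(p² + q²)` under `(p, q) ↦ (r p, r q)`. -/
theorem hom_aux_fst {r : ℝ} (hr : r ≠ 0) (p q : ℝ) : r * p / ((r * p) ^ 2 + (r * q) ^ 2) = r⁻¹ * (p / (p ^ 2 + q ^ 2)) := by
  rw [show (r * p) ^ 2 + (r * q) ^ 2 = r * (r * (p ^ 2 + q ^ 2)) by ring, mul_div_mul_left _ _ hr, div_mul_eq_div_div_swap,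
    div_eq_mul_inv, mul_comm]

/-- degree `−1` homogeneity of `q/(p² + q²)` under `(p, q) ↦ (r p, r q)`. -/
theorem hom_aux_snd {r : ℝ} (hr : r ≠ 0) (p q : ℝ) : r * q / ((r * p) ^ 2 + (r * q) ^ 2) = r⁻¹ * (q / (p ^ 2 + q ^ 2)) := by
  rw [show (r * p) ^ 2 + (r * q) ^ 2 = r * (r * (p ^ 2 + q ^ 2)) by ring, mul_div_mul_left _ _ hr, div_mul_eq_div_div_swap,
    div_eq_mul_inv, mul_comm]

/-- `Re K` closed form is homogeneous of degree `−1` under dilation. -/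
theorem pairReForm_smul {r : ℝ} (hr : r ≠ 0) (x t ξ b : ℝ) :
    pairReForm (r * x) (r * t) (r * ξ) (r * b) = r⁻¹ * pairReForm x t ξ b := by
  unfold pairReForm
  rw [← mul_sub, ← mul_sub, ← mul_add, hom_aux_fst hr, hom_aux_fst hr, ← mul_add]

/-- `c` closed form is homogeneous of degree `−1` under dilation. -/
theorem pairCForm_smul {r : ℝ} (hr : r ≠ 0) (δ t ξ b : ℝ) :
    pairCForm (r * δ) (r * t) (r * ξ) (r * b) = r⁻¹ * pairCForm δ t ξ b := by
  unfold pairCForm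
  rw [← mul_sub, ← mul_sub, ← mul_add, hom_aux_snd hr, hom_aux_snd hr, ← mul_add]

/-- the first-slot-zero instances (the axis points `p₀ = xv + i t`, `p₁ = xv + i h` have offset `0 = r·0`). -/
theorem pairReForm_smul_zero {r : ℝ} (hr : r ≠ 0) (t ξ b : ℝ) : pairReForm 0 (r * t) (r * ξ) (r * b) = r⁻¹ * pairReForm 0 t ξ b := by
  have h := pairReForm_smul hr 0 t ξ b; rwa [mul_zero] at h

/-- `pairCForm_smul` at `δ = 0` (reading points on the axis). -/
theorem pairCForm_smul_zero {r : ℝ} (hr : r ≠ 0) (t ξ b : ℝ) : pairCForm 0 (r * t) (r * ξ) (r * b) = r⁻¹ * pairCForm 0 t ξ b := by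
  have h := pairCForm_smul hr 0 t ξ b; rwa [mul_zero] at h

/-- `Re K_v(w)` is homogeneous of degree `−1` under dilation of the datum. -/
theorem kerRe_smul {r : ℝ} (hr : r ≠ 0) (δ t Y : ℝ) : kerRe (r * δ) (r * t) (r * Y) = r⁻¹ * kerRe δ t Y := by
  have h := pairReForm_smul hr δ t 0 Y; rw [mul_zero] at h; rw [kerRe, kerRe, h]

/-- `Im K_v(w)` is homogeneous of degree `−1` under dilation of the datum. -/
theorem kerIm_smul {r : ℝ} (hr : r ≠ 0) (δ t Y : ℝ) : kerIm (r * δ) (r * t) (r * Y) = r⁻¹ * kerIm δ t Y := by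
  have h := pairCForm_smul hr δ t 0 Y; rw [mul_zero] at h; rw [kerIm, kerIm, h, mul_neg]

/-- `‖K_v(w)‖` is homogeneous of degree `−1` under dilation of the datum (`0 < r`). -/
theorem kerNorm_smul {r : ℝ} (hr : 0 < r) (δ t Y : ℝ) : kerNorm (r * δ) (r * t) (r * Y) = r⁻¹ * kerNorm δ t Y := by
  rw [kerNorm, kerNorm, kerRe_smul hr.ne', kerIm_smul hr.ne',
    show (r⁻¹ * kerRe δ t Y) ^ 2 + (r⁻¹ * kerIm δ t Y) ^ 2 = r⁻¹ ^ 2 * (kerRe δ t Y ^ 2 + kerIm δ t Y ^ 2) by ring,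
    Real.sqrt_mul (sq_nonneg _), Real.sqrt_sq (inv_pos.2 hr).le]

/-- the member-A numerator is homogeneous of degree `−1` under dilation (`0 < r`). -/
theorem footANumForm_smul {r : ℝ} (hr : 0 < r) (δ t Y ξ b : ℝ) :
    footANumForm (r * δ) (r * t) (r * Y) (r * ξ) (r * b) = r⁻¹ * footANumForm δ t Y ξ b := by
  have hr' := hr.ne'
  unfold footANumForm
  rw [kerRe_smul hr', kerIm_smul hr', kerNorm_smul hr, pairReForm_smul hr', pairReForm_smul_zero hr', pairCForm_smul hr',
    pairCForm_smul_zero hr',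
    show r⁻¹ * kerRe δ t Y * (r⁻¹ * pairReForm δ t ξ b - r⁻¹ * pairReForm 0 t ξ b) +
        r⁻¹ * kerIm δ t Y * (r⁻¹ * pairCForm 0 t ξ b - r⁻¹ * pairCForm δ t ξ b) =
      r⁻¹ * (r⁻¹ * (kerRe δ t Y * (pairReForm δ t ξ b - pairReForm 0 t ξ b) + kerIm δ t Y * (pairCForm 0 t ξ b - pairCForm δ t ξ b))) by ring,
    mul_div_mul_left _ _ (inv_ne_zero hr'), mul_div_assoc, ← mul_neg]

/-- the member-Ti numerator is homogeneous of degree `−1` under dilation. -/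
theorem topINumForm_smul {r : ℝ} (hr : r ≠ 0) (δ t h ξ b : ℝ) :
    topINumForm (r * δ) (r * t) (r * h) (r * ξ) (r * b) = r⁻¹ * topINumForm δ t h ξ b := by
  unfold topINumForm
  rw [pairCForm_smul hr, pairCForm_smul_zero hr, mul_sub]

/-! ## §2 invariance of the boundary forms and of the alternatives under dilation -/

/-- cancel a positive factor `r⁻¹` in `≤`. -/
theorem inv_mul_le_inv_mul_iff {r : ℝ} (hr : 0 < r) (a b : ℝ) : r⁻¹ * a ≤ r⁻¹ * b ↔ a ≤ b :=
  ⟨fun h => by simpa [hr.ne'] using mul_le_mul_of_nonneg_left h hr.le, fun h => mul_le_mul_of_nonneg_left h (inv_pos.2 hr).le⟩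

/-- cancel a positive factor `r⁻¹` in `<`. -/
theorem inv_mul_lt_inv_mul_iff {r : ℝ} (hr : 0 < r) (a b : ℝ) : r⁻¹ * a < r⁻¹ * b ↔ a < b :=
  ⟨fun h => by simpa [hr.ne'] using mul_lt_mul_of_pos_left h hr, fun h => mul_lt_mul_of_pos_left h (inv_pos.2 hr)⟩

/-- reparametrising a column `b ∈ [0, r·Hs]` by `b = r·b'`. -/
theorem forall_column_smul {r : ℝ} (hr : 0 < r) (Hs : ℝ) (P : ℝ → Prop) :
    (∀ b : ℝ, 0 ≤ b → b ≤ r * Hs → P b) ↔ (∀ b : ℝ, 0 ≤ b → b ≤ Hs → P (r * b)) := by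
  constructor
  · intro hP b hb hbH
    exact hP (r * b) (mul_nonneg hr.le hb) (mul_le_mul_of_nonneg_left hbH hr.le)
  · intro hP b hb hbH
    have hle := mul_le_mul_of_nonneg_left hbH (inv_pos.2 hr).le
    rw [inv_mul_cancel_left₀ hr.ne'] at hle
    have key := hP (r⁻¹ * b) (mul_nonneg (inv_pos.2 hr).le hb) hle
    rwa [mul_inv_cancel_left₀ hr.ne'] at key

/-- reparametrising a lid ray `±ξ ≥ r·R/2` by `ξ = r·ξ'`. -/
theorem forall_lid_smul {r : ℝ} (hr : 0 < r) (c : ℝ) (P : ℝ → Prop) :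
    (∀ ξ : ℝ, r * c ≤ ξ → P ξ) ↔ (∀ ξ : ℝ, c ≤ ξ → P (r * ξ)) := by
  constructor
  · intro hP ξ hξ
    exact hP (r * ξ) (mul_le_mul_of_nonneg_left hξ hr.le)
  · intro hP ξ hξ
    have hle := mul_le_mul_of_nonneg_left hξ (inv_pos.2 hr).le
    rw [inv_mul_cancel_left₀ hr.ne'] at hle
    have key := hP (r⁻¹ * ξ) hle
    rwa [mul_inv_cancel_left₀ hr.ne'] at key

/-- reparametrise the LEFT lid ray `r·c ≤ −ξ` by `ξ ↦ r ξ`. -/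
theorem forall_lid_neg_smul {r : ℝ} (hr : 0 < r) (c : ℝ) (P : ℝ → Prop) :
    (∀ ξ : ℝ, r * c ≤ -ξ → P ξ) ↔ (∀ ξ : ℝ, c ≤ -ξ → P (r * ξ)) := by
  constructor
  · intro hP ξ hξ
    exact hP (r * ξ) (by rw [← mul_neg]; exact mul_le_mul_of_nonneg_left hξ hr.le)
  · intro hP ξ hξ
    have hle := mul_le_mul_of_nonneg_left hξ (inv_pos.2 hr).le
    rw [inv_mul_cancel_left₀ hr.ne'] at hle
    have key := hP (r⁻¹ * ξ) (by rwa [← mul_neg])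
    rwa [mul_inv_cancel_left₀ hr.ne'] at key

/-- one scaled inequality: `r⁻¹·N ≤ σ·(r⁻¹·C) ⇔ N ≤ σ·C`. -/
theorem smul_ineq_iff {r : ℝ} (hr : 0 < r) (N σ C : ℝ) : r⁻¹ * N ≤ σ * (r⁻¹ * C) ↔ N ≤ σ * C := by
  rw [mul_left_comm, inv_mul_le_inv_mul_iff hr]

/-- ★ (K∂_thin) for read A is dilation invariant. -/
theorem thinBdryDomFormA_smul {r : ℝ} (hr : 0 < r) (R Hs δ t Y σ : ℝ) :
    ThinBdryDomFormA (r * R) (r * Hs) (r * δ) (r * t) (r * Y) σ ↔ ThinBdryDomFormA R Hs δ t Y σ := by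
  unfold ThinBdryDomFormA
  rw [mul_div_assoc, ← mul_neg, forall_column_smul hr, forall_column_smul hr, forall_lid_smul hr, forall_lid_neg_smul hr]
  simp only [footANumForm_smul hr, pairCForm_smul hr.ne', smul_ineq_iff hr]

/-- ★ (K∂_thin) for read Ti is dilation invariant. -/
theorem thinBdryDomFormTi_smul {r : ℝ} (hr : 0 < r) (R Hs h δ t σ : ℝ) :
    ThinBdryDomFormTi (r * R) (r * Hs) (r * h) (r * δ) (r * t) σ ↔ ThinBdryDomFormTi R Hs h δ t σ := by
  unfold ThinBdryDomFormTi
  rw [mul_div_assoc, ← mul_neg, forall_column_smul hr, forall_column_smul hr, forall_lid_smul hr, forall_lid_neg_smul hr]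
  simp only [topINumForm_smul hr.ne', pairCForm_smul hr.ne', smul_ineq_iff hr]

/-- ★ (D) for read A is dilation invariant (the scale `s` dilates with the datum). -/
theorem altFormA_smul {r : ℝ} (hr : 0 < r) (lam s δ t Y σ : ℝ) :
    AltFormA lam (r * s) (r * δ) (r * t) (r * Y) σ ↔ AltFormA lam s δ t Y σ := by
  unfold AltFormA
  rw [kerNorm_smul hr, kerIm_smul hr.ne', mul_div_assoc,
    show r⁻¹ * kerNorm δ t Y - σ * (r⁻¹ * kerIm δ t Y) = r⁻¹ * (kerNorm δ t Y - σ * kerIm δ t Y) by ring,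
    show 1 / (2 * (r * s)) = r⁻¹ * (1 / (2 * s)) by rw [mul_left_comm, one_div, mul_inv, one_div],
    inv_mul_le_inv_mul_iff hr, inv_mul_lt_inv_mul_iff hr]

/-- ★ (D) for read Ti is dilation invariant. -/
theorem altFormTi_smul {r : ℝ} (hr : 0 < r) (lam s δ t Y σ : ℝ) :
    AltFormTi lam (r * s) (r * δ) (r * t) (r * Y) σ ↔ AltFormTi lam s δ t Y σ := by
  unfold AltFormTi
  rw [kerNorm_smul hr, kerIm_smul hr.ne', mul_div_assoc, mul_left_comm (1 - σ),
    show 1 / (2 * (r * s)) = r⁻¹ * (1 / (2 * s)) by rw [mul_left_comm, one_div, mul_inv, one_div],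
    inv_mul_le_inv_mul_iff hr, inv_mul_lt_inv_mul_iff hr]

/-! ## §3 the `R = 2` normal form of the right menu law and the equivalence -/

/-- THE RIGHT MENU LAW IN `R = 2` NORMAL FORM (real closed form; OPEN, conjecture-shaped, asserted by nothing): window `2`, far columns `ξ = ±1`,
lid `1 − h`; binders scale `s`, box top `h` (`3h < 2`), child `(δ, t)` with `0 ≤ δ`, parent height `Y`. -/
def MenuThinNFRealSig (lam : ℝ) : Prop :=
  ∀ (s h δ t Y : ℝ),
    0 < s → 2 * s ≤ h → 3 * h < 2 → 0 < Y → Y ≤ h → 0 < t → t < Y → Y - s / 4 < t → δ ^ 2 + t ^ 2 ≤ Y ^ 2 → 0 ≤ δ →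
    (∃ σ : ℝ, ThinBdryDomFormA 2 (1 - h) δ t Y σ ∧ AltFormA lam s δ t Y σ) ∨
    (∃ σ : ℝ, ThinBdryDomFormTi 2 (1 - h) h δ t σ ∧ AltFormTi lam s δ t Y σ)

/-- the right real menu law at every window `R` gives the `R = 2` normal form (instance `R = 2`, `xv`-free). -/
theorem menuThinNFRealSig_of_real {lam : ℝ} (hM : MenuThinRightRealSig lam) : MenuThinNFRealSig lam := by
  intro s h δ t Y hs hsh h3 hY hYh ht htY hdrop hnest hδ
  have key := hM 2 s h δ t Y hs hsh h3 hY hYh ht htY hdrop hnest hδ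
  have e : (2 : ℝ) / 2 - h = 1 - h := by norm_num
  rwa [e] at key

/-- the general window is the dilate `r = 2/R` of the normal form (the datum, the scale `s` and the box dilate together; `σ` is unchanged). -/
theorem menuThinRightRealSig_of_NF {lam : ℝ} (hN : MenuThinNFRealSig lam) : MenuThinRightRealSig lam := by
  intro R s h δ t Y hs hsh h3 hY hYh ht htY hdrop hnest hδ
  have hR : 0 < R := by linarith
  obtain ⟨r, hrR, hr⟩ : ∃ r : ℝ, r * R = 2 ∧ 0 < r := ⟨2 / R, div_mul_cancel₀ 2 hR.ne', div_pos two_pos hR⟩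
  have key := hN (r * s) (r * h) (r * δ) (r * t) (r * Y) (mul_pos hr hs) (by nlinarith) (by nlinarith) (mul_pos hr hY)
    (mul_le_mul_of_nonneg_left hYh hr.le) (mul_pos hr ht) (mul_lt_mul_of_pos_left htY hr) (by nlinarith)
    (by have hsq := mul_le_mul_of_nonneg_left hnest (sq_nonneg r); linear_combination hsq) (mul_nonneg hr.le hδ)
  have e1 : (2 : ℝ) = r * R := hrR.symm
  have e2 : 1 - r * h = r * (R / 2 - h) := by linear_combination (-(1 : ℝ) / 2) * hrR
  rw [e1, e2] at key
  rcases key with ⟨σ, hK, hD⟩ | ⟨σ, hK, hD⟩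
  · exact Or.inl ⟨σ, (thinBdryDomFormA_smul hr R _ δ t Y σ).1 hK, (altFormA_smul hr lam s δ t Y σ).1 hD⟩
  · exact Or.inr ⟨σ, (thinBdryDomFormTi_smul hr R _ h δ t σ).1 hK, (altFormTi_smul hr lam s δ t Y σ).1 hD⟩

/-- ★★ THE REAL RIGHT MENU LAW ⇔ ITS `R = 2` NORMAL FORM. -/
theorem menuThinRightRealSig_iff_NF (lam : ℝ) : MenuThinRightRealSig lam ↔ MenuThinNFRealSig lam :=
  ⟨menuThinNFRealSig_of_real, menuThinRightRealSig_of_NF⟩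

/-- ★★ THE RIGHT MENU LAW (model language, E2's binders) ⇔ THE `R = 2` REAL NORMAL FORM (`0 < lam`). -/
theorem menuThinRightSig_iff_NF {lam : ℝ} (hlam : 0 < lam) : MenuThinRightSig lam ↔ MenuThinNFRealSig lam :=
  (menuThinRightSig_iff hlam).trans (menuThinRightRealSig_iff_NF lam)

/-- the producer-side consequence: the `R = 2` real normal form + thin Lemma H give E2's RIGHT thin certificate law. -/
theorem certificatesExistRightThinSig_of_NF {lam : ℝ} (hlam : 0 < lam) (hH : LemmaHThinSig) (hN : MenuThinNFRealSig lam) :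
    CertificatesExistRightThinSig lam :=
  certificatesExistRightThinSig_of_menuRight hH ((menuThinRightSig_iff_NF hlam).2 hN)

/-- … and E2's FULL thin certificate law (mirror). -/
theorem certificatesExistThinSig_of_NF {lam : ℝ} (hlam : 0 < lam) (hH : LemmaHThinSig) (hN : MenuThinNFRealSig lam) :
    CertificatesExistThinSig lam :=
  thinMirrorSig lam (certificatesExistRightThinSig_of_NF hlam hH hN)

/-! ## §4 CERTIFICATE FORM — explicit multipliers: four POINTWISE boundary inequalities per datum imply the menu (the shape «rh33346-thincert» checks)

For a STRICTLY nested datum (`δ² + t² < Y²`, equivalently `Im K > 0`) the existential multiplier `σ` of each menu member can be WITNESSED in closed form: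
A-sector `σ = κ·‖K‖/Im K` (ratio `κ` with `1/lam ≤ 1 − κ`; the kit's `Asec: Φ(u) ≤ κ‖K‖²`), A-half-plane `σ = (‖K‖ − B)/Im K` (`Ahp`, level `B > 1/(2s)`),
Ti-sector `σ = 1 − ‖K‖/(lam·Im K)` (`Tisec`), Ti-half-plane `σ = 1 − B/Im K` (`Tihp`).  On the nesting circle `δ² + t² = Y²` (`Im K = 0`) these witnesses are
junk and the menu is a separate (soft) statement `MenuThinNFEdgeSig`. -/

/-- `0 ≤ ‖K‖` in closed form. -/
theorem kerNorm_nonneg (δ t Y : ℝ) : 0 ≤ kerNorm δ t Y := Real.sqrt_nonneg _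

/-- `Im K > 0` exactly for strictly nested children: by #1279's product identity `pairCForm_mul` (`c·E₋E₊ = 2t((δ−ξ)² + t² − b²)` at `ξ = 0`, `b = Y`). -/
theorem kerIm_pos {δ t Y : ℝ} (ht : 0 < t) (htY : t < Y) (hnest : δ ^ 2 + t ^ 2 < Y ^ 2) : 0 < kerIm δ t Y := by
  have hm : 0 < (δ - 0) ^ 2 + (t - Y) ^ 2 := by nlinarith [sq_nonneg δ]
  have hp : 0 < (δ - 0) ^ 2 + (t + Y) ^ 2 := by nlinarith [sq_nonneg δ]
  have hneg : pairCForm δ t 0 Y * (((δ - 0) ^ 2 + (t - Y) ^ 2) * ((δ - 0) ^ 2 + (t + Y) ^ 2)) < 0 := by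
    rw [pairCForm_mul δ t 0 Y hm.ne' hp.ne', sub_zero]
    exact mul_neg_of_pos_of_neg (by positivity) (by linarith)
  have hc : pairCForm δ t 0 Y < 0 := by
    rcases lt_or_ge (pairCForm δ t 0 Y) 0 with h | h
    · exact h
    · nlinarith [mul_nonneg h (mul_pos hm hp).le]
  unfold kerIm
  linarith

/-- read A, SECTOR: (K∂_thin) with the explicit multiplier `κ·‖K‖/Im K`, `0 ≤ κ`, `1/lam ≤ 1 − κ` ⇒ the A-member certifies (first alternative; on the circle too). -/
theorem menuA_of_sector {lam κ R Hs s δ t Y : ℝ} (hκ0 : 0 ≤ κ) (hκ : 1 / lam ≤ 1 - κ)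
    (hK : ThinBdryDomFormA R Hs δ t Y (κ * kerNorm δ t Y / kerIm δ t Y)) :
    ∃ σ : ℝ, ThinBdryDomFormA R Hs δ t Y σ ∧ AltFormA lam s δ t Y σ := by
  refine ⟨_, hK, Or.inl ?_⟩
  have hN := kerNorm_nonneg δ t Y
  by_cases h0 : kerIm δ t Y = 0
  · rw [h0, div_zero, zero_mul, sub_zero, div_eq_mul_one_div]
    exact mul_le_of_le_one_right hN (by linarith)
  · rw [div_mul_cancel₀ _ h0, div_eq_mul_one_div]
    linear_combination mul_le_mul_of_nonneg_left hκ hN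

/-- read A, HALF-PLANE: explicit multiplier `(‖K‖ − B)/Im K` at a level `B > 1/(2s)` ⇒ the A-member certifies (second alternative). -/
theorem menuA_of_halfPlane {lam B R Hs s δ t Y : ℝ} (hB : 1 / (2 * s) < B) (h0 : kerIm δ t Y ≠ 0)
    (hK : ThinBdryDomFormA R Hs δ t Y ((kerNorm δ t Y - B) / kerIm δ t Y)) :
    ∃ σ : ℝ, ThinBdryDomFormA R Hs δ t Y σ ∧ AltFormA lam s δ t Y σ :=
  ⟨_, hK, Or.inr (by rwa [div_mul_cancel₀ _ h0, sub_sub_cancel])⟩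

/-- read Ti, SECTOR: explicit multiplier `1 − ‖K‖/(lam·Im K)` ⇒ the Ti-member certifies (first alternative, with equality). -/
theorem menuTi_of_sector {lam R Hs h s δ t Y : ℝ} (h0 : kerIm δ t Y ≠ 0)
    (hK : ThinBdryDomFormTi R Hs h δ t (1 - kerNorm δ t Y / lam / kerIm δ t Y)) :
    ∃ σ : ℝ, ThinBdryDomFormTi R Hs h δ t σ ∧ AltFormTi lam s δ t Y σ :=
  ⟨_, hK, Or.inl (le_of_eq (by rw [sub_sub_cancel, div_mul_cancel₀ _ h0]))⟩

/-- read Ti, HALF-PLANE: explicit multiplier `1 − B/Im K` at a level `B > 1/(2s)` ⇒ the Ti-member certifies (second alternative). -/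
theorem menuTi_of_halfPlane {lam B R Hs h s δ t Y : ℝ} (hB : 1 / (2 * s) < B) (h0 : kerIm δ t Y ≠ 0)
    (hK : ThinBdryDomFormTi R Hs h δ t (1 - B / kerIm δ t Y)) :
    ∃ σ : ℝ, ThinBdryDomFormTi R Hs h δ t σ ∧ AltFormTi lam s δ t Y σ :=
  ⟨_, hK, Or.inr (by rwa [sub_sub_cancel, div_mul_cancel₀ _ h0])⟩

/-- THE CERTIFICATE FORM of the `R = 2` menu law at sector ratio `κ` (OPEN on the whole box; «rh33346-thincert» checks it leaf by leaf on its covered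
sub-box with `κ = 27/256`, `lam² = 5/4`): for every STRICTLY nested normal-form datum one of A-sector(κ) · A-half-plane(B) · Ti-sector(lam) · Ti-half-plane(B). -/
def MenuThinCertFormSig (lam κ : ℝ) : Prop :=
  ∀ (s h δ t Y : ℝ),
    0 < s → 2 * s ≤ h → 3 * h < 2 → 0 < Y → Y ≤ h → 0 < t → t < Y → Y - s / 4 < t → δ ^ 2 + t ^ 2 < Y ^ 2 → 0 ≤ δ →
    ThinBdryDomFormA 2 (1 - h) δ t Y (κ * kerNorm δ t Y / kerIm δ t Y) ∨
    (∃ B : ℝ, 1 / (2 * s) < B ∧ ThinBdryDomFormA 2 (1 - h) δ t Y ((kerNorm δ t Y - B) / kerIm δ t Y)) ∨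
    ThinBdryDomFormTi 2 (1 - h) h δ t (1 - kerNorm δ t Y / lam / kerIm δ t Y) ∨
    (∃ B : ℝ, 1 / (2 * s) < B ∧ ThinBdryDomFormTi 2 (1 - h) h δ t (1 - B / kerIm δ t Y))

/-- the EDGE residual: the menu law ON the nesting circle `δ² + t² = Y²` (`Im K = 0`; there `L_A = ‖K‖` for every `σ`, so the A-member certifies as soon as
`sup_∂ N_A/c < ∞` and `1 ≤ lam` — a soft compactness statement, not a certificate inequality; OPEN as typed). -/
def MenuThinNFEdgeSig (lam : ℝ) : Prop :=
  ∀ (s h δ t Y : ℝ),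
    0 < s → 2 * s ≤ h → 3 * h < 2 → 0 < Y → Y ≤ h → 0 < t → t < Y → Y - s / 4 < t → δ ^ 2 + t ^ 2 = Y ^ 2 → 0 ≤ δ →
    (∃ σ : ℝ, ThinBdryDomFormA 2 (1 - h) δ t Y σ ∧ AltFormA lam s δ t Y σ) ∨
    (∃ σ : ℝ, ThinBdryDomFormTi 2 (1 - h) h δ t σ ∧ AltFormTi lam s δ t Y σ)

/-- ★★ CERTIFICATE FORM (strictly nested data) + EDGE residual ⇒ the `R = 2` menu law, for every `lam`, `κ` with `0 ≤ κ`, `1/lam ≤ 1 − κ`. -/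
theorem menuThinNFRealSig_of_certForm {lam κ : ℝ} (hκ0 : 0 ≤ κ) (hκ : 1 / lam ≤ 1 - κ) (hC : MenuThinCertFormSig lam κ)
    (hE : MenuThinNFEdgeSig lam) : MenuThinNFRealSig lam := by
  intro s h δ t Y hs hsh h3 hY hYh ht htY hdrop hnest hδ
  rcases hnest.lt_or_eq with hlt | heq
  · have h0 := (kerIm_pos ht htY hlt).ne'
    rcases hC s h δ t Y hs hsh h3 hY hYh ht htY hdrop hlt hδ with hA | ⟨B, hB, hA⟩ | hT | ⟨B, hB, hT⟩
    · exact Or.inl (menuA_of_sector hκ0 hκ hA)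
    · exact Or.inl (menuA_of_halfPlane hB h0 hA)
    · exact Or.inr (menuTi_of_sector h0 hT)
    · exact Or.inr (menuTi_of_halfPlane hB h0 hT)
  · exact hE s h δ t Y hs hsh h3 hY hYh ht htY hdrop heq hδ

/-- the kit's constants are admissible: `κ = 27/256` and `lam = √5/2` satisfy `1/lam ≤ 1 − κ` (`512² = 262144 ≤ 262205 = 229²·5`). -/
theorem kit_ratio_admissible : 1 / (Real.sqrt 5 / 2) ≤ 1 - 27 / 256 := by
  have h5 : (512 : ℝ) / 229 ≤ Real.sqrt 5 := Real.le_sqrt_of_sq_le (by norm_num)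
  have hpos : 0 < Real.sqrt 5 := Real.sqrt_pos.2 (by norm_num)
  rw [one_div_div, div_le_iff₀ hpos]
  nlinarith

/-- NON-VACUITY of the normal-form binders (`s = 1/4`, `h = Y = 1/2`, `t = 15/32`, `δ = 0`). -/
theorem nf_binders_inhabited : ∃ (s h δ t Y : ℝ),
    0 < s ∧ 2 * s ≤ h ∧ 3 * h < 2 ∧ 0 < Y ∧ Y ≤ h ∧ 0 < t ∧ t < Y ∧ Y - s / 4 < t ∧ δ ^ 2 + t ^ 2 ≤ Y ^ 2 ∧ 0 ≤ δ :=
  ⟨1 / 4, 1 / 2, 0, 15 / 32, 1 / 2, by norm_num⟩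

end RhW08.MenuThinNF

end
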